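import Mathlib.GroupTheory.Nilpotent
import Mathlib.GroupTheory.Exponent
import Mathlib.FieldTheory.IsAlgClosed.AlgebraicClosure
import Literature.Barriers.MatrixMultiplication.TricoloredSumFreeBarrier
import Literature.RepresentationTheory.FiniteGroups.CharacterDegrees
import HarnessLib

/-!
# Barrier: slice rank of modular group algebras — nilpotent groups of bounded exponent and class, and powers of a fixed group, cannot give `ω = 2` (Blasiak–Church–Cohn–Grochow–Umans 2017; Sawin 2018)

Topic `Literature/Barriers/MatrixMultiplication` (D-0021 barrier catalogue for the summit
`MatrixMultiplication`, `ω(ℂ) = 2`; group-theoretic approach, non-abelian STPP line; companion of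
`TricoloredSumFreeBarrier.lean` (abelian bounded exponent), `QuasirandomBarrier.lean` and
`NormalizerBarrier.lean` (matrix groups / Lie type) and `YoungSubgroupBarrier.lean` (`Sₙ`)).

Sources.
* J. Blasiak, T. Church, H. Cohn, J. A. Grochow, C. Umans, *Which groups are amenable to proving
  exponent two for matrix multiplication?*, arXiv:1712.02302v1 (2017) [BlasiakChurchCohnGrochowUmans2017]
  (arXiv numbering, checked on a fetched PDF: Def. 2.1, Def. 2.5, Thm. 2.6, Thm. 2.8, Thm. 2.9,
  Prop. 2.10, Cor. 2.11 (§2); Lemma 3.1, Prop. 3.2, Lemma 3.3, Def. 3.4–3.7, Thm. 3.8, Cor. 3.9,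
  Prop. 3.10, Thm. 3.11, Ex. 3.12–3.15, Lemma 3.16–3.18, Thm. 3.19, Cor. 3.20, Lemma 3.21 (§3);
  §5; App. B: Prop. B.6, Cor. B.7, Thm. B.8). The held store copy `paper:arxiv-1712.02302` has a
  wrong title in its metadata but the right text.
* W. Sawin, *Bounds for matchings in nonabelian groups*, arXiv:1702.00905 (2017), Electron. J.
  Combin. 25 (2018) [Sawin2018] (fetched PDF: Lemma 1.3, Lemma 1.4, Thm. 1.5 p. 2–4; Thm. 2.12,
  Thm. 3.10 quoted in the introduction).

## Catalogue entry

The D-0021 structured block is in the docstring of the catalogue declaration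
`NilpotentGroupBarrier` at the end of this file.

## Content

* `IsMulMatching s t u` — multiplicative matchings (BCCGU Def. 2.1), with
  `isTricoloredSumFree_iff_isMulMatching` (the tree's additive notion is the abelian case) and
  **Prop. 2.10 PROVED**: `IsMulMatching.card_le_sliceRank` (`|M| ≤ slice-rank(D_G)` over any
  field; Tao's lemma from `SliceRankMethod.lean` through the bridge of
  `TricoloredSumFreeBarrier.lean`).
* **`sliceRank_groupTensor` PROVED**: the tree's multiplication-table tensor `groupTensor K G`
  (`M_G`, `GroupAlgebraTensor.lean`) and `D_G = mulGroupTensor K G` have the same slice rank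
  (Sawin's remark in the proof of Lemma 1.4; via `HasSliceRankLE.rotate`).
* **Descent PROVED**: `HasSliceRankLE.map`, `sliceRank_map_le` (slice rank can only drop under
  extension of scalars), whence the App. B facts — stated over algebraically closed fields as
  printed — are DERIVED over every field (`BCCGU2017_propB6.of_field`, `_corB7.of_field`,
  `_thmB8.of_field`).
* **Lemma 3.1 PROVED**: `HasSliceRankLE.of_restrict`
  (`slice-rank(F) ≤ slice-rank(F|_{X̂×Y×Z}) + |X ∖ X̂|`).
* Named facts (statements only, STPP = CKSU Def. 5.1 = the tree's `SimultaneousTPP`):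
  `BCCGU2017_cor320` (Cor. 3.20, effective reading), `BCCGU2017_cor211` (Cor. 2.11 for one group
  all of whose powers obey the slice-rank bound),
  `Sawin2018_thm15`, `Sawin2018_lem13`, and the LIMITS of the method: `BCCGU2017_propB6`
  (`slice-rank ⟨n,n,n⟩ = n²`), `BCCGU2017_corB7` (semisimple group algebras have full slice rank),
  `BCCGU2017_thmB8` (cyclic groups have full slice rank in every characteristic).
* Catalogue entry `NilpotentGroupBarrier : Prop` (Cor. 3.20 ∧ Cor. 2.11 ∧ Sawin Thm. 1.5) with
  the D-0021 block and projections.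

## Design choices and wording risks

* **Effective reading of "cannot achieve `ω = 2`".** BCCGU's negative results say that the
  bound on `ω` deducible from the CKSU inequality (2.2) `∑ᵢ(|Sᵢ||Tᵢ||Uᵢ|)^{ω/3} ≤ ∑ⱼ dⱼ^ω`
  (BCCGU Thm. 2.6) stays bounded away from `2` over the family. The printed route (packing defect
  by Thm. 2.9 + slice rank, then Thm. 2.8 = BCCGNSU Lemma 2.4) yields `∑ xᵢ^{w/3} ≤ |G| ≤ ∑ dⱼ^w`
  AT `w = 2 + ε`, which is the form vendored — the same reading as the tree's
  `BlasiakChurchCohnGrochowNaslundSawinUmans2017_B` for the abelian Thm. B.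
* **Which STPP.** BCCGU's printed Def. 2.5 mixes conventions: clause (1) is its Def. 2.2 (TPP with
  right quotients `xy⁻¹`), clause (2) is printed with left quotients `s⁻¹s' t⁻¹t' u⁻¹u'`; for
  non-abelian groups the two placements give different predicates (a review exhibited explicit
  examples in `S₃`). The theorems BCCGU invoke (Thm. 2.6 "[CKSU05]", packing bounds, Thm. 2.8–2.9)
  are those of Cohn–Kleinberg–Szegedy–Umans 2005, Def. 5.1 (right quotients throughout) — the tree's
  `Literature.Combinatorics.Additive.SimultaneousTPP` — which is therefore the notion used in all Lean facts here.
* **Cor. 2.11 and powers.** Slice rank is not submultiplicative (BCCGNSU Prop. 4.2 only gives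
  `slice-rank(F ⊗ G) ≤ slice-rank(F) · |side of G|`), and the proof of Cor. 2.11 runs through
  matchings in POWERS `G^N` (Thm. 2.9); the families of §3 are closed under powers (for `G^N`,
  the `p`-degrees scale by `N`, `δ_{G^N} = N δ_G`). We therefore vendor Cor. 2.11 for one group
  together with all its powers: `slice-rank(D_{G^N}) ≤ |G|^{N(1−δ)}` for all `N ≥ 1`.
* Thm. 3.8, Thm. 3.11, Thm. 3.19 and Lemma 3.21 involve the `p`-degrees of the Jennings
  (`p`-lower central) series, augmentation ideals and "bounded variance / linear expectation" of
  families; they are cited in the block, and only the cleanly closed Cor. 3.20 (bounded exponent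
  AND bounded nilpotency class; Mathlib `Group.IsNilpotent`, `Group.nilpotencyClass`,
  `Monoid.exponent`) is a Lean statement.
* `D_G(x,y,z) = [xyz = 1]` (`mulGroupTensor`) is used in the statements; it has the same slice
  rank as the tree's multiplication-table tensor `groupTensor K G` = `M_G` (`sliceRank_groupTensor`,
  proved): "the same as the multiplication tensor but with the last variable inverted, so it has
  the same slice rank" (Sawin, proof of Lemma 1.4).
* Sawin's `δ < 1` is existential as printed (any witness is `> 0`).
* **What "bounded exponent" does in the printed `p`-group theorem (audit 2026-08-15).** Thm. 3.8
  is stated for "families of `p`-groups of bounded exponent" whose `p`-degrees have bounded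
  variance or linear expectation, but its proof (§3, proof of the main `p`-group theorem) uses
  the exponent bound only through "Since the exponent is bounded, `p` is bounded, and the latter
  form is equivalent to saying that `δ_G ≥ Ω(n)`": what is proved is
  `slice-rank(M_G) ≤ |G|^{1−Ω(1)}` for `p`-groups with `p = O(1)` and
  `δ_G = (∑ j rⱼ)²/∑ j² rⱼ = Ω(log_p |G|)` (Thm. 3.11 with Lemmas 3.16–3.17). This is how Ex. 3.15
  rules out the unitriangular groups `UT_m(𝔽_p)` for FIXED `p` and `m → ∞` although that family
  has exponent `p^{⌈log_p m⌉} → ∞`, nilpotency class `m − 1 → ∞` and `p`-lower central series of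
  length `m − 1` (so it is an instance of NEITHER Cor. 3.9 nor Cor. 3.20): `r_j = m − j`, linear
  expectation `E X_r = (m+1)/3 ≥ ℓ/3`, `δ_G = Ω(m²)`. Consequently `UT_m(𝔽_p)`, `m → ∞`, is
  covered by the PRINTED barrier (Thm. 3.11 + Cor. 2.11) but by no conjunct of the Lean
  `NilpotentGroupBarrier` below (`BCCGU2017_cor320` needs bounded exponent AND class;
  `BCCGU2017_cor211` only conditionally on a slice-rank hypothesis not proved in the tree for this
  family); with `p` and `m` both fixed it is a fixed group and falls under (b)/Cor. 3.20.
* **Tightness of the method (App. A; audit 2026-08-15).** Every `p`-group of order `p^n` carries a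
  BORDER multiplicative matching of cardinality `≥ p^n/2^n` (Thm. A.6, from Prop. A.4 for `ℤ/p`
  and the extension Lemma A.5); a border matching of cardinality `m` in `G` yields honest
  matchings of cardinality `≥ m^N/(2Nt+1)^3` in `G^N` (Lemma A.2), hence by Prop. 2.10
  `slice-rank(M_{G^N}) ≥ m^N/(2Nt+1)^3` for every `N` (and `slice-rank(M_G) ≥ m`, Prop. A.3 — whose
  printed "proof using powers of `G`" appeals to "slice rank is submultiplicative", false in
  general: `δ_{x,0}δ_{y,z}` and `δ_{y',0}δ_{x',z'}` have slice rank `1` while their tensor product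
  restricts to a diagonal of size `n`; the statement survives because `{slice-rank ≤ r}` is
  Zariski closed and a border matching is a degeneration to `⟨m⟩`, and Cor. 2.11 only ever needs
  the power form of Lemma A.2); for nilpotent `G` of order `p^n r`, `(p,r) = 1`,
  `slice-rank_{𝔽_p}(M_G) ≥ 3p^n r/2^{n+2}` (Thm. A.7). So the hypothesis of the Key Corollary 2.11,
  `slice-rank(M_{G^N}) ≤ |G|^{N(1−δ)}` for all `N`, forces `δ ≤ log 2/log p` on `p`-groups: the
  slice-rank METHOD (not only the theorems vendored here) proves nothing of the form `|G|^{1−Ω(1)}`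
  for `p`-groups with `p → ∞`, e.g. the Heisenberg / extraspecial groups over `𝔽_p`, `p → ∞`
  (class `2`, exponent `p`). (App. A numbering: the arXiv version numbers all environments of a
  section with one counter, as in §3 and App. B — checked on the held text, where App. B's items
  B.1 = Def. (flat rank), B.4 = Thm., B.6 = Prop., B.7 = Cor., B.8 = Thm., B.9 = Lemma appear as
  consecutive items; hence A.1 = Def. (border matchings), A.2 = Lemma (conversion to powers),
  A.3 = Prop. (slice-rank lower bound), A.4 = Prop. (`ℤ/m`), A.5 = Lemma (extensions),
  A.6 = Thm. (`p`-groups), A.7 = Thm. (nilpotent groups).)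
* **What the entry does NOT block: graded (separating-subset) certificates (audit 2026-08-15).**
  The chain Thm. 2.8 ⟹ Thm. 2.9 ⟹ Prop. 2.10 starts from "proving `ω = 2` VIA INEQUALITY (2.2)",
  whose right-hand side `∑_{all irreps} d_j^ω ≥ |G|` is what turns `ω = 2` into the packing bound
  `∑|Sᵢ||Tᵢ| ≥ |G|^{1−o(1)}` and then into matchings of size `|G|^{N(1−o(1))}`. Blasiak–Cohn–
  Grochow–Pratt–Umans (ITCS 2025), Thm. 2.2 (in the tree, corrected and PROVED:
  `Literature.Computability.AlgebraicComplexity.BCGPU2024_thm_2_2_corrected_holds`) certifies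
  `(|X||Y||Z|)^{ω/3} ≤ ∑_{ρ ∈ R_sep} (dim ρ)^ω` from ONE TPP triple and ANY set `R_sep` of
  representations whose matrix coefficients separate `X Z⁻¹` inside `X Y⁻¹ Y Z⁻¹` — for finite `G`
  with `R_sep = Irr(G)` this is Cohn–Umans' Thm. 4.1, but with `R_sep ⊊ Irr(G)` the benchmark is
  `D = ∑_{R_sep} d_ρ² ≪ |G|` and the authors note "It is even conceivable that this result could
  be used to improve the bounds from known constructions of TPPs in finite groups, by using only a
  subset of the group's irreducible representations" (§1.1). For such certificates slice rank
  yields exactly `|X|·|Z|`-type volume caps — for `|X| = |Y| = |Z| = n`, `n² ≤ slice-rank_K(D_G)`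
  over every field (`BCCGU2017_propB6.sq_le_sliceRank_of_realizesTPP` below: the triple embeds
  `⟨n,n,n⟩`, of full slice rank `n²`, into `D_G`), i.e. `n ≤ |G|^{(1−δ)/2}` in the hosts of this
  entry — which is no obstruction when `D ≪ |G|`. The one case that folds back into this entry is
  `R_sep = Irr(G/K)` for a normal subgroup `K` (tests constant on `K`-cosets): then the certificate
  is (2.2) in the quotient `G/K`, again nilpotent of bounded exponent and class. Route
  `MatrixMultiplication/LevelGradedCohnUmans` runs the graded programme in `Sₙ` and `GL_n(𝔽_q)`
  and declares this entry "not in class"; by the above, bounded-exponent nilpotent hosts are not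
  excluded from that programme by anything in this file either.
* **Status (audit 2026-08-15).** All three conjuncts, and the App. B limits, are PROVED in the
  tree with axioms `{propext, Classical.choice, Quot.sound}`: `NilpotentGroupBarrier_holds`,
  `BCCGU2017_cor320_holds`, `BCCGU2017_thmB8_holds` (`NilpotentGroupBarrierProofs.lean`),
  `BCCGU2017_cor211_holds` (`NilpotentGroupBarrierMatchings.lean`), `Sawin2018_thm15_holds`,
  `Sawin2018_lem13_holds` (`NilpotentGroupBarrierSawin.lean`), `BCCGU2017_propB6_holds`,
  `BCCGU2017_corB7_holds` (`NilpotentGroupBarrierSemisimple.lean`); those files import this one,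
  so the catalogue Prop stays a `def` here and the audit only sharpened the prose of the block
  (technique_class (a) and the `UT_m` example, evasions (iv)–(viii), caveats (f)–(h)) and added
  the volume-cap theorem `BCCGU2017_propB6.sq_le_sliceRank_of_realizesTPP`.
-/

noncomputable section

open scoped BigOperators

namespace Literature.Barriers.MatrixMultiplication

open Literature.RepresentationTheory.FiniteGroups Literature.Combinatorics.Additive

universe u v

/-! ## Multiplicative matchings (BCCGU 2017, Def. 2.1) and Prop. 2.10 -/

section Matching

variable {G : Type u} [Group G] {ι : Type v}

/-- **Multiplicative matching** in a group `G` (Blasiak–Church–Cohn–Grochow–Umans 2017, Def. 2.1: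
"three sequences `(s₁,…,sₙ), (t₁,…,tₙ), (u₁,…,uₙ)` of elements of `G` such that
`sᵢ tⱼ u_k = 1 ⟺ i = j = k`. The cardinality of this multiplicative matching is `n`"; "coincides
with what were called tricolored sum-free sets in [BCC⁺17]" — the tree's
`Literature.Combinatorics.Additive.IsTricoloredSumFree` is the additive abelian case,
`isTricoloredSumFree_iff_isMulMatching`). Indexed by an arbitrary type `ι` (cardinality `|ι|`).
Sawin 2018 uses the SET form ("a triple of subsets `S, T, U` in `G` such that the subset
`M ⊆ S × T × U` consisting of triples `(s,t,u)` satisfying `stu = 1` is a perfect matching of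
`S × T × U` … The cardinality … is `|M| = |S| = |T| = |U|`"); indexing `M` by `ι` gives the form
below, and conversely the three sequences of an indexed matching are injective
(`IsMulMatching.injective_left`) with ranges `S, T, U` — the same dictionary as for the tree's
`IsTricoloredSumFree` versus BCCGNSU Def. 3.1.
[cite: BlasiakChurchCohnGrochowUmans2017, Def. 2.1] [cite: Sawin2018, §0 (Definition)] -/
def IsMulMatching (s t u : ι → G) : Prop :=
  ∀ i j k, s i * t j * u k = 1 ↔ (i = j ∧ j = k)

/-- Matched triples multiply to `1`. [folklore] -/
theorem IsMulMatching.diag {s t u : ι → G} (h : IsMulMatching s t u) (i : ι) :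
    s i * t i * u i = 1 :=
  (h i i i).2 ⟨rfl, rfl⟩

/-- The first sequence of a multiplicative matching is injective. [folklore] -/
theorem IsMulMatching.injective_left {s t u : ι → G} (h : IsMulMatching s t u) :
    Function.Injective s := by
  intro i i' hi
  have h1 : s i' * t i * u i = 1 := by rw [← hi]; exact h.diag i
  exact ((h i' i i).1 h1).1.symm

/-- A multiplicative matching in a finite group has cardinality at most `|G|`. [folklore] -/
theorem IsMulMatching.card_le [Fintype G] [Fintype ι] {s t u : ι → G} (h : IsMulMatching s t u) :
    Fintype.card ι ≤ Fintype.card G :=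
  Fintype.card_le_of_injective s h.injective_left

/-- In an additive abelian group, tricolored sum-free sets (BCCGNSU Def. 3.1, the tree's
`IsTricoloredSumFree`) are exactly the multiplicative matchings of `Multiplicative H`.
[cite: BlasiakChurchCohnGrochowUmans2017, Def. 2.1] -/
theorem isTricoloredSumFree_iff_isMulMatching {H : Type u} [AddCommGroup H] (s t u : ι → H) :
    IsTricoloredSumFree s t u ↔
      IsMulMatching (Multiplicative.ofAdd ∘ s) (Multiplicative.ofAdd ∘ t)
        (Multiplicative.ofAdd ∘ u) :=
  Iff.rfl

/-- **BCCGU 2017, Prop. 2.10** (Tao; = Sawin 2018, Lemma 1.4: "the cardinality of a multiplicative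
matching in `H` is at most the slice rank of the multiplication tensor of `H` over `k`"), PROVED
for the tensor `D_G(x,y,z) = [xyz = 1]` (`mulGroupTensor`; "the same as the multiplication tensor
but with the last variable inverted, so it has the same slice rank"): a multiplicative matching of
cardinality `|ι|` forces `|ι| ≤ slice-rank(D_G)` over any field — by Tao's Lemma 4.7 of BCCGNSU
(the tree's `HasSliceRankLE.card_le_of_matching`).
[cite: BlasiakChurchCohnGrochowUmans2017, Prop. 2.10] -/
theorem IsMulMatching.card_le_sliceRank {K : Type v} [Field K] [Fintype G] [DecidableEq G]
    [Fintype ι] {s t u : ι → G} (h : IsMulMatching s t u) :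
    Fintype.card ι ≤ sliceRank (mulGroupTensor K G) :=
  (hasSliceRankLE_sliceRank (K := K) (mulGroupTensor K G)).card_le_of_matching s t u
    fun i j l => by simp [mulGroupTensor_apply, h i j l]

end Matching

/-! ## `M_G` versus `D_G`: same slice rank (proved) -/

section MulTable

variable {K : Type v} [Field K] {X Y Z : Type*}

/-- Slice decompositions are insensitive to a cyclic rotation of the three slots
(`x`-slices become the new third-slot slices, etc.). [folklore] -/
theorem _root_.Literature.Combinatorics.Additive.HasSliceRankLE.rotate {D : X → Y → Z → K} {k : ℕ}
    (h : HasSliceRankLE D k) : HasSliceRankLE (fun y z x => D x y z) k := by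
  obtain ⟨kx, ky, kz, hk, f₁, g₁, f₂, g₂, f₃, g₃, hD⟩ := h
  refine ⟨ky, kz, kx, by omega, f₂, fun r z x => g₂ r x z, f₃, fun r y x => g₃ r x y, f₁,
    fun r y z => g₁ r y z, fun y z x => ?_⟩
  show D x y z = _
  rw [hD x y z]
  simp only
  ring

variable (K) (G : Type u) [Group G] [DecidableEq G] [Fintype G]

/-- **`slice-rank(M_G) = slice-rank(D_G)`** for the tree's multiplication-table tensor
`groupTensor K G z x y = [xy = z]` (`GroupAlgebraTensor.lean`; BCCGU 2017, §2.3) and the diagonal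
form `D_G(x,y,z) = [xyz = 1]` ("This is the same as the multiplication tensor but with the last
variable inverted, so it has the same slice rank" — Sawin 2018, proof of Lemma 1.4): rotate the
slots and pull back along `z ↦ z⁻¹`, in both directions. PROVED. [cite: Sawin2018, Lemma 1.4 (proof)] -/
theorem sliceRank_groupTensor : sliceRank (Literature.Computability.AlgebraicComplexity.groupTensor K G) = sliceRank (mulGroupTensor K G) := by
  apply le_antisymm
  · -- `M_G(z,x,y) = D_G(x,y,z⁻¹)`: rotate `D_G` twice, then invert the (new) first slot
    have h := ((hasSliceRankLE_sliceRank (K := K) (mulGroupTensor K G)).rotate.rotate).comp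
      (·⁻¹) id id
    refine (hasSliceRankLE_iff_sliceRank_le _ _).1 ?_
    convert h using 1
    funext z x y
    simp only [id, Literature.Computability.AlgebraicComplexity.groupTensor_apply, mulGroupTensor_apply, mul_inv_eq_one]
  · -- `D_G(x,y,z) = M_G(z⁻¹,x,y)`: rotate `M_G` once, then invert the third slot
    have h := ((hasSliceRankLE_sliceRank (K := K) (Literature.Computability.AlgebraicComplexity.groupTensor K G)).rotate).comp id id (·⁻¹)
    refine (hasSliceRankLE_iff_sliceRank_le _ _).1 ?_
    convert h using 1
    funext x y z
    simp only [id, Literature.Computability.AlgebraicComplexity.groupTensor_apply, mulGroupTensor_apply, mul_eq_one_iff_eq_inv]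

end MulTable

/-! ## Extension of scalars can only lower the slice rank (proved) -/

section Descent

variable {K : Type v} [Field K] {L : Type*} [Field L] {X Y Z : Type*}

/-- Slice decompositions push forward along a ring homomorphism (extension of scalars): a
`k`-slice decomposition of `D` over `K` gives one of `f ∘ D` over `L`. [folklore] -/
theorem _root_.Literature.Combinatorics.Additive.HasSliceRankLE.map (f : K →+* L) {D : X → Y → Z → K} {k : ℕ}
    (h : HasSliceRankLE D k) : HasSliceRankLE (fun x y z => f (D x y z)) k := by
  obtain ⟨kx, ky, kz, hk, f₁, g₁, f₂, g₂, f₃, g₃, hD⟩ := h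
  refine ⟨kx, ky, kz, hk, fun r x => f (f₁ r x), fun r y z => f (g₁ r y z), fun r y => f (f₂ r y),
    fun r x z => f (g₂ r x z), fun r z => f (f₃ r z), fun r x y => f (g₃ r x y), fun x y z => ?_⟩
  show f (D x y z) = _
  rw [hD x y z]
  simp only [map_add, map_sum, map_mul]

/-- Hence `slice-rank_L(f ∘ D) ≤ slice-rank_K(D)`: the slice rank over an extension field is at
most the slice rank over the base field (BCCGU 2017, App. B, remark after Thm. B.4: lower bounds
proved over the algebraic closure descend to every field). [cite: BlasiakChurchCohnGrochowUmans2017, App. B (remark after Thm. B.4)] -/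
theorem sliceRank_map_le [Fintype X] (f : K →+* L) (D : X → Y → Z → K) :
    sliceRank (fun x y z => f (D x y z)) ≤ sliceRank D :=
  ((hasSliceRankLE_sliceRank D).map f).sliceRank_le

/-- `0/1`-tensors are defined over every field compatibly: `f ∘ D_G = D_G`. [folklore] -/
theorem map_mulGroupTensor (f : K →+* L) (G : Type u) [Group G] [DecidableEq G] :
    (fun x y z => f (mulGroupTensor K G x y z)) = mulGroupTensor L G := by
  funext x y z
  simp only [mulGroupTensor_apply, apply_ite f, map_one, map_zero]

/-- `f ∘ D_H = D_H` for the additive group tensor. [folklore] -/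
theorem map_addGroupTensor (f : K →+* L) (H : Type u) [AddGroup H] [DecidableEq H] :
    (fun x y z => f (addGroupTensor K H x y z)) = addGroupTensor L H := by
  funext x y z
  simp only [addGroupTensor_apply, apply_ite f, map_one, map_zero]

/-- `f ∘ ⟨k,m,n⟩ = ⟨k,m,n⟩`. [folklore] -/
theorem map_matMulTensor (f : K →+* L) (k m n : ℕ) :
    (fun x y z => f (Literature.Computability.AlgebraicComplexity.matMulTensor K k m n x y z)) = Literature.Computability.AlgebraicComplexity.matMulTensor L k m n := by
  funext x y z
  simp only [Literature.Computability.AlgebraicComplexity.matMulTensor, apply_ite f, map_one, map_zero]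

end Descent

/-! ## BCCGU 2017, Lemma 3.1: restricting one coordinate (proved) -/

section Restrict

variable {K : Type v} [Field K] {X Y Z : Type*}

/-- **BCCGU 2017, Lemma 3.1** ("For a function `F : X × Y × Z → 𝔽` and a subset `X̂ ⊆ X`, we have
`slice-rank(F) ≤ slice-rank(F|_{X̂×Y×Z}) + |X| − |X̂|`"), in `HasSliceRankLE` form with
`X̂ = {x | P x}`: extend the slices of the restriction by zero and add one `x`-slice
`δ_w(x) · F(w,·,·)` for each `w ∉ X̂`. [cite: BlasiakChurchCohnGrochowUmans2017, Lemma 3.1] -/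
theorem HasSliceRankLE.of_restrict [Fintype X] [DecidableEq X] (D : X → Y → Z → K)
    (P : X → Prop) [DecidablePred P] {k : ℕ}
    (h : HasSliceRankLE (fun (x : {x // P x}) y z => D x y z) k) :
    HasSliceRankLE D (k + Fintype.card {x // ¬ P x}) := by
  classical
  obtain ⟨kx, ky, kz, hk, f₁, g₁, f₂, g₂, f₃, g₃, hD⟩ := h
  -- new `x`-slices: the old ones extended by zero, plus one per `w ∉ X̂`
  let F₁ : Fin kx ⊕ {x // ¬ P x} → X → K := fun r x =>
    match r with
    | Sum.inl r => if hx : P x then f₁ r ⟨x, hx⟩ else 0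
    | Sum.inr w => if x = w then 1 else 0
  let G₁ : Fin kx ⊕ {x // ¬ P x} → Y → Z → K := fun r y z =>
    match r with
    | Sum.inl r => g₁ r y z
    | Sum.inr w => D w y z
  let G₂ : Fin ky → X → Z → K := fun r x z => if hx : P x then g₂ r ⟨x, hx⟩ z else 0
  let G₃ : Fin kz → X → Y → K := fun r x y => if hx : P x then g₃ r ⟨x, hx⟩ y else 0
  have key := hasSliceRankLE_of_fintype D F₁ G₁ f₂ G₂ f₃ G₃ (fun x y z => by
    simp only [F₁, G₁, G₂, G₃, Fintype.sum_sum_type]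
    by_cases hx : P x
    · -- inside `X̂`: the extra slices vanish and the old decomposition applies
      have h0 : ∑ w : {x // ¬ P x}, (if x = (w : X) then (1 : K) else 0) * D w y z = 0 := by
        refine Finset.sum_eq_zero fun w _ => ?_
        have : x ≠ (w : X) := fun hxw => w.2 (hxw ▸ hx)
        simp [this]
      rw [h0, add_zero]
      simp only [hx, dif_pos]
      exact hD ⟨x, hx⟩ y z
    · -- outside `X̂`: only the slice `w = x` survives
      simp only [hx, dif_neg, not_false_eq_true, zero_mul, Finset.sum_const_zero, zero_add,
        mul_zero, add_zero]
      rw [Finset.sum_eq_single ⟨x, hx⟩]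
      · simp
      · rintro ⟨w, hw⟩ _ hne
        have : x ≠ w := fun hxw => hne (Subtype.ext hxw.symm)
        simp [this]
      · simp)
  refine key.mono ?_
  simp only [Fintype.card_sum, Fintype.card_fin]
  omega

end Restrict


/-! ## Named facts -/

section Facts

/-- **BCCGU 2017, Corollary 3.20** ("STPP constructions in families of nilpotent groups of bounded
exponent and bounded nilpotency class cannot achieve `ω = 2`"), in the effective reading used by the
tree for BCCGNSU Thm. B (`BlasiakChurchCohnGrochowNaslundSawinUmans2017_B`): for all bounds `m`
(exponent) and `c` (class) there is `ε > 0` such that for every finite nilpotent group `G` with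
`exponent G ≤ m` and `nilpotencyClass G ≤ c` and every STPP construction `(Sᵢ, Tᵢ, Uᵢ)_{i<N}` in
`G` (Cohn–Kleinberg–Szegedy–Umans 2005, Def. 5.1 = the tree's `SimultaneousTPP`; see the module
docstring for BCCGU's printed Def. 2.5), the CKSU inequality (2.2)
`∑ᵢ (|Sᵢ||Tᵢ||Uᵢ|)^{w/3} ≤ ∑ⱼ dⱼ^w` already holds AT `w = 2 + ε` — so (2.2), which is all the
framework knows about `ω`, cannot certify `ω < 2 + ε` (this is what the printed proof yields:
a packing defect and Thm. 2.8 = BCCGNSU Lemma 2.4 give `∑ xᵢ^{w/3} ≤ |G| ≤ ∑ dⱼ^w` at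
`w = 2/(1−ε')`). `∑ⱼ dⱼ^w = charDegreePowSum G w` (tree). Proof in print: Thm. 3.19(1) via Thm. 3.8,
Thm. 3.11 (slice rank of `𝔽_p[P]` for a large Sylow `P`), Lemma 3.21 and Cor. 2.11.
[cite: BlasiakChurchCohnGrochowUmans2017, Cor. 3.20] -/
def BCCGU2017_cor320 : Prop :=
  ∀ m c : ℕ, ∃ ε : ℝ, 0 < ε ∧
    ∀ (G : Type) [Group G] [Fintype G] [Group.IsNilpotent G],
      Monoid.exponent G ≤ m → Group.nilpotencyClass G ≤ c →
      ∀ (N : ℕ) (S T U : Fin N → Finset G), SimultaneousTPP S T U →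
        ∑ i, (((S i).card * (T i).card * (U i).card : ℕ) : ℝ) ^ ((2 + ε) / 3) ≤
          charDegreePowSum G (2 + ε)

/-- **BCCGU 2017, Corollary 2.11 ("Key corollary") in the form its proof gives for ONE group all of
whose powers obey a uniform slice-rank bound** ("Given a family of groups `G` with
`slice-rank(M_G) ≤ |G|^{1−Ω(1)}`, no STPP construction in this family can prove `ω = 2` via
Inequality (2.2)" — the family being used through the powers `G^N` of Thm. 2.9): for every
`δ > 0` there is `ε > 0` such that if, over some field `K`, `slice-rank(D_{G^N}) ≤ |G|^{N(1−δ)}`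
for all `N ≥ 1`, then every STPP construction in `G` (CKSU Def. 5.1, the tree's `SimultaneousTPP`)
satisfies (2.2) at `w = 2 + ε`. [cite: BlasiakChurchCohnGrochowUmans2017, Cor. 2.11 and Thm. 2.9] -/
def BCCGU2017_cor211 : Prop :=
  ∀ δ : ℝ, 0 < δ → ∃ ε : ℝ, 0 < ε ∧
    ∀ (G : Type) [Group G] [Fintype G] [DecidableEq G] (K : Type) [Field K],
      (∀ N : ℕ, 1 ≤ N →
        (sliceRank (mulGroupTensor K (Fin N → G)) : ℝ) ≤
          (Fintype.card G : ℝ) ^ ((N : ℝ) * (1 - δ))) →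
      ∀ (N : ℕ) (S T U : Fin N → Finset G), SimultaneousTPP S T U →
        ∑ i, (((S i).card * (T i).card * (U i).card : ℕ) : ℝ) ^ ((2 + ε) / 3) ≤
          charDegreePowSum G (2 + ε)

/-- **Sawin 2018, Theorem 1.5** ("Let `G` be a nontrivial finite group. There exists a constant
`δ < 1` such that any multiplicative matching in `Gⁿ` has size at most `δⁿ|G|ⁿ`"), via Lemma 1.3
(for `p ∣ |G|`, `𝔽_p[G]` is not semisimple, whence `slice-rank_{𝔽_p}(M_{Gⁿ}) ≤ 3δⁿ|G|ⁿ`) and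
Lemma 1.4 (= BCCGU Prop. 2.10) with an amplification removing the factor `3`. With BCCGU Thm. 2.8 /
2.9 this rules out `ω = 2` from STPP constructions in the family `{Gⁿ}` of powers of one fixed
group ("unless `|G| = O(1)` and the family is `{Gⁿ}`", BCCGU §1.1).
[cite: Sawin2018, Thm. 1.5] -/
def Sawin2018_thm15 : Prop :=
  ∀ (G : Type) [Group G] [Fintype G], Nontrivial G → ∃ δ : ℝ, δ < 1 ∧
    ∀ (n : ℕ) (ι : Type) [Fintype ι] (s t u : ι → (Fin n → G)), IsMulMatching s t u →
      (Fintype.card ι : ℝ) ≤ δ ^ n * (Fintype.card G : ℝ) ^ n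

/-- **Sawin 2018, Lemma 1.3** ("Let `G` be a finite group, and let `p` be a prime dividing `|G|`.
There exists a constant `δ < 1` such that the slice rank of the multiplication tensor of `Gⁿ` over
`𝔽_p` is at most `3δⁿ|G|ⁿ`"), for the tensor `D_{Gⁿ}(x,y,z) = [xyz = 1]` (same slice rank as the
multiplication tensor, Sawin Lemma 1.4 (proof)). [cite: Sawin2018, Lemma 1.3] -/
def Sawin2018_lem13 : Prop :=
  ∀ (G : Type) [Group G] [Fintype G] [DecidableEq G] (p : ℕ) [Fact p.Prime], p ∣ Fintype.card G →
    ∃ δ : ℝ, δ < 1 ∧ ∀ n : ℕ,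
      (sliceRank (mulGroupTensor (ZMod p) (Fin n → G)) : ℝ) ≤ 3 * δ ^ n * (Fintype.card G : ℝ) ^ n

/-- **BCCGU 2017, Proposition B.6** ("The flat rank and slice rank of the square matrix
multiplication tensor `⟨n,n,n⟩` are full"), slice-rank part: `slice-rank ⟨n,n,n⟩ = n²`
(the tree's `matMulTensor K n n n`, format `(n×n)³`). So upper bounds on slice rank can never bound
`ω` (BCCGNSU Rem. 4.9). Fields: App. B works over an algebraically closed field ("the latter part
of this argument depended on the field being infinite … in all of our results bounding slice rank
we could have been working in an algebraically closed field without loss of generality", remark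
after Thm. B.4; B.6 rests on Flanders' theorem), so the fact is stated for `[IsAlgClosed K]`; the
all-fields form is DERIVED below (`BCCGU2017_propB6.of_field`: slice rank can only drop under
extension of scalars, `sliceRank_map_le`, and `≤ n²` is trivial).
[cite: BlasiakChurchCohnGrochowUmans2017, Prop. B.6] -/
def BCCGU2017_propB6 : Prop :=
  ∀ (K : Type) [Field K] [IsAlgClosed K] (n : ℕ), sliceRank (Literature.Computability.AlgebraicComplexity.matMulTensor K n n n) = n ^ 2

/-- **BCCGU 2017, Corollary B.7** ("the flat rank and slice rank of any semisimple group algebra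
`𝔽[G]` are equal to `|G|`"; via `𝔽[G] ≅ ⊕ M_{dᵢ}(𝔽)`, i.e. over a splitting field of characteristic
not dividing `|G|`): "to get any nontrivial upper bounds on `slice-rank(M_G)`, one has to work
over a field whose characteristic divides `|G|`". Stated for algebraically closed `K` with
`char K ∤ |G|` (App. B's standing reduction, remark after Thm. B.4) and for
`D_G(x,y,z) = [xyz = 1]` (`mulGroupTensor`, same slice rank as `M_G`, `sliceRank_groupTensor`); the
all-fields form is DERIVED below (`BCCGU2017_corB7.of_field`).
[cite: BlasiakChurchCohnGrochowUmans2017, Cor. B.7] -/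
def BCCGU2017_corB7 : Prop :=
  ∀ (K : Type) [Field K] [IsAlgClosed K] (G : Type) [Group G] [Fintype G] [DecidableEq G],
    (Fintype.card G : K) ≠ 0 → sliceRank (mulGroupTensor K G) = Fintype.card G

/-- **BCCGU 2017, Theorem B.8** ("For any cyclic group `G = ℤ/nℤ`,
`flat-rank(M_G) = slice-rank(M_G) = |G|` in any characteristic"), slice-rank part, for the additive
group tensor `D_{ℤ/nℤ}(x,y,z) = [x + y + z = 0]` (`addGroupTensor`), `n ≥ 1`: the slice-rank method
proves nothing for cyclic groups (large 3-AP-free / tricolored sum-free sets may exist there).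
"In any characteristic" is stated here for algebraically closed fields of each characteristic
(the printed proof: Lemma B.9 for `𝔽_p[ℤ/p^r]` plus Cor. B.7 for the part coprime to `p`, with
App. B's standing reduction to an algebraically closed field, remark after Thm. B.4); the form over
every field is DERIVED below (`BCCGU2017_thmB8.of_field`).
[cite: BlasiakChurchCohnGrochowUmans2017, Thm. B.8] -/
def BCCGU2017_thmB8 : Prop :=
  ∀ (K : Type) [Field K] [IsAlgClosed K] (n : ℕ) [NeZero n], sliceRank (addGroupTensor K (ZMod n)) = n

/-- Prop. B.6 over EVERY field, derived: `slice-rank_K ⟨n,n,n⟩ ≥ slice-rank_{K̄} ⟨n,n,n⟩ = n²`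
(`sliceRank_map_le` along `K → K̄ = AlgebraicClosure K`) and `≤ n²` trivially (`sliceRank_le_card`).
[cite: BlasiakChurchCohnGrochowUmans2017, Prop. B.6 and App. B (remark after Thm. B.4)] -/
theorem BCCGU2017_propB6.of_field (h : BCCGU2017_propB6) (K : Type) [Field K] (n : ℕ) :
    sliceRank (Literature.Computability.AlgebraicComplexity.matMulTensor K n n n) = n ^ 2 := by
  apply le_antisymm
  · simpa [sq] using sliceRank_le_card (Literature.Computability.AlgebraicComplexity.matMulTensor K n n n)
  · calc n ^ 2 = sliceRank (Literature.Computability.AlgebraicComplexity.matMulTensor (AlgebraicClosure K) n n n) := (h _ n).symm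
      _ = sliceRank (fun x y z => algebraMap K (AlgebraicClosure K) (Literature.Computability.AlgebraicComplexity.matMulTensor K n n n x y z)) := by
          rw [map_matMulTensor]
      _ ≤ sliceRank (Literature.Computability.AlgebraicComplexity.matMulTensor K n n n) := sliceRank_map_le _ _

/-- Cor. B.7 over EVERY field of characteristic not dividing `|G|`, derived by the same descent.
[cite: BlasiakChurchCohnGrochowUmans2017, Cor. B.7 and App. B (remark after Thm. B.4)] -/
theorem BCCGU2017_corB7.of_field (h : BCCGU2017_corB7) (K : Type) [Field K] (G : Type) [Group G]
    [Fintype G] [DecidableEq G] (hchar : (Fintype.card G : K) ≠ 0) :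
    sliceRank (mulGroupTensor K G) = Fintype.card G := by
  apply le_antisymm (sliceRank_le_card _)
  have hL : (Fintype.card G : AlgebraicClosure K) ≠ 0 := by
    intro h0
    apply hchar
    apply (algebraMap K (AlgebraicClosure K)).injective
    rw [map_natCast, map_zero, h0]
  calc Fintype.card G = sliceRank (mulGroupTensor (AlgebraicClosure K) G) := (h _ G hL).symm
    _ = sliceRank (fun x y z => algebraMap K (AlgebraicClosure K) (mulGroupTensor K G x y z)) := by
        rw [map_mulGroupTensor]
    _ ≤ sliceRank (mulGroupTensor K G) := sliceRank_map_le _ _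

/-- Thm. B.8 over EVERY field, derived by the same descent.
[cite: BlasiakChurchCohnGrochowUmans2017, Thm. B.8 and App. B (remark after Thm. B.4)] -/
theorem BCCGU2017_thmB8.of_field (h : BCCGU2017_thmB8) (K : Type) [Field K] (n : ℕ) [NeZero n] :
    sliceRank (addGroupTensor K (ZMod n)) = n := by
  apply le_antisymm
  · simpa using sliceRank_le_card (addGroupTensor K (ZMod n))
  · calc n = sliceRank (addGroupTensor (AlgebraicClosure K) (ZMod n)) := (h _ n).symm
      _ = sliceRank (fun x y z => algebraMap K (AlgebraicClosure K) (addGroupTensor K (ZMod n) x y z)) := by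
          rw [map_addGroupTensor]
      _ ≤ sliceRank (addGroupTensor K (ZMod n)) := sliceRank_map_le _ _

end Facts

/-! ## Catalogue entry (D-0021) -/

section Catalogue

/-- **Slice rank of `𝔽_p[G]` bounds multiplicative matchings, hence STPP constructions, in
nilpotent groups of bounded exponent and class and in powers of a fixed group
(Blasiak–Church–Cohn–Grochow–Umans 2017, §3; Sawin 2018).** The catalogue entry is
Cor. 3.20 ∧ Cor. 2.11 ∧ Sawin Thm. 1.5 (named facts, effective readings as explained in the module
docstring).

BARRIER
technique_class: group-theoretic-approach, Cohn–Kleinberg–Szegedy–Umans STPP constructions (CKSU Def. 5.1 = the tree's `SimultaneousTPP`; BCCGU Def. 2.5) in NON-ABELIAN finite groups, read through the FULL-BUDGET CKSU inequality (2.2) `∑ᵢ(|Sᵢ||Tᵢ||Uᵢ|)^{ω/3} ≤ ∑ⱼ dⱼ^ω` (all irreducible degrees of the host on the right): (a) finite `p`-groups with `p` BOUNDED whose `p`-degrees `(rⱼ)` (Jennings / `p`-lower central series, Def. 3.4–3.5) give `δ_G = (∑ j rⱼ)²/∑ j² rⱼ = Ω(log_p|G|)` — `p`-degrees of bounded variance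 or of linear expectation suffice (Thm. 3.8, printed for "bounded exponent", a hypothesis its proof uses only as "`p` is bounded", see the module docstring) — and finite nilpotent groups of bounded exponent whose Sylow subgroups are such (Thm. 3.19); in particular — the ONLY case that is a conjunct of this Prop, `BCCGU2017_cor320` — nilpotent groups of bounded exponent AND bounded nilpotency class (`Group.IsNilpotent`, `Monoid.exponent ≤ m`, `Group.nilpotencyClass ≤ c`; Cor. 3.9 / Cor. 3.20), e.g. `(ℤ/p^kℤ)^m` (`p`, `k` fixed, `m → ∞`), Heisenberg / extraspecial groups `p^{1+2k}` over a FIXED `𝔽_p` (`k → ∞`), direct powers of any fixed `p`-group; and, in PRINT ONLY, `UT_m(𝔽_p)` with `p` fixed and `m → ∞` (unbounded exponent and class; Ex. 3.15: linear expectation, `δ_G = Ω(m²)`); (b) the family `{Gⁿ}` of powers of one fixed non-trivial finite group (Sawin, Thm. 1.5; in the tree also in the effective STPP form `Sawin2018_thm15_stpp`, see caveat (d)) and, IN PRINT ONLY (Sawin Thm. 2.10(2)/2.12, BCCGU Lemma 3.21; caveat (i)), overgroups `K ⊵ Hⁿ` of a fixed non-trivial `H` whose conjugation action preserves Sawin's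 degree filtration (e.g. `Hⁿ ⋊ Pₙ`, `Pₙ ≤ Sₙ` permuting coordinates) with `log[K : Hⁿ] = O(n)`, and products of non-trivial groups of bounded order; (b′) IN PRINT ONLY (audit 2026-08-17, gen 2), the fixed-group hosts of (b) under the whole GALACTIC METHOD of Alman–Vassilevska Williams — monomial degenerations (zeroing-outs after identifying variables) of the tensor powers `T_G^{⊗n} = T_{Gⁿ}` of the group tensor into disjoint sums of matrix multiplication tensors, read through the asymptotic sum inequality; STPP/(2.2) is "a particular technique within the Solar method" — for ONE fixed non-trivial finite group: a zeroing-out of `T_{Gⁿ}` to an independent tensor of size `m` IS a multiplicative matching of size `m` in `Gⁿ`, so `Ĩ(T_G) ≤ δ_G|G| < |G| ≤ R̃(T_G)` and `ω_g(T_G) > 2` (Lemma 6.1, Cor. 6.1, Thm. 6.1 of the arXiv text); (c) any family closed under powers with `slice-rank(M_G) ≤ |G|^{1−Ω(1)}` (Key Corollary 2.11)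
blocks: certifying `MatrixMultiplication` (`ω = 2`) via (2.2) from STPP constructions in: "families of nilpotent groups `G` … if they have bounded exponent and either (1) they have bounded variance, or (2) they have linear expectation" [cite: BlasiakChurchCohnGrochowUmans2017, Thm. 3.19], in particular "families of nilpotent groups of bounded exponent and bounded nilpotency class" (`BCCGU2017_cor320`) [cite: BlasiakChurchCohnGrochowUmans2017, Cor. 3.20] and of `p`-groups of bounded exponent with bounded length of the `p`-lower central series [cite: BlasiakChurchCohnGrochowUmans2017, Thm. 3.8 and Cor. 3.9]; and — in print only, not a conjunct of this Prop (unbounded exponent and class, `p` fixed, linear-expectation `p`-degrees) — in `UT_m(𝔽_p)`, `p` fixed, `m → ∞`, where `slice-rank(M_G) ≤ p^{(m²−m)/2}/e^{Ω(m²)}` "indeed rules out obtaining `ω = 2` via STPP constructions in these groups" [cite: BlasiakChurchCohnGrochowUmans2017, Ex. 3.15 and Thm. 3.11]; more generally in any family (closed under powers) with `slice-rank(M_G) ≤ |G|^{1−Ω(1)}` (`BCCGU2017_cor211`) [cite: BlasiakChurchCohnGrochowUmans2017, Cor. 2.11]; and in powers `Gⁿ` of a fixed non-trivial group, where multiplicative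 matchings have size `≤ δⁿ|G|ⁿ`, `δ < 1` (`Sawin2018_thm15`) [cite: Sawin2018, Thm. 1.5] — a bound "never of the form `|G|^{1−c}`, which is what is needed to rule out proving `ω = 2` in a family of groups (unless `|G| = O(1)` and the family is `{Gⁿ}`)" [cite: BlasiakChurchCohnGrochowUmans2017, §1.1]; and, IN PRINT ONLY, certifying `ω = 2` by the Galactic method applied to the group tensor `T_G` of ONE fixed finite group ("no fixed group `G` can yield `ω = 2` by using the Galactic method applied to `T_G`") [cite: AlmanVassilevskaWilliams2018, Thm. 6.1 and Cor. 6.1]. Constrains the route item `CNonabelianTPPFamilies` / STPP variants of `MatrixMultiplication/GroupTheoreticSTPP`.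
because: `ω = 2` via STPP in a family ⟹ the family meets the packing bound (Thm. 2.8 = BCCGNSU Lemma 2.4) ⟹ multiplicative matchings of size `|G|^{N(1−ε)}` in powers `G^N` (Thm. 2.9) ⟹ `slice-rank(M_{G^N}) ≥ |G|^{N(1−ε)}` (Prop. 2.10, Tao — `IsMulMatching.card_le_sliceRank`, proved) [cite: BlasiakChurchCohnGrochowUmans2017, §2.3 (Thm. 2.8–Cor. 2.11)]; upper bounds: `slice-rank(M_𝒟) ≤ codim A + codim B + dim C` whenever `A·B ⊆ C` in an algebra `𝒟` (Lemma 3.1 — `HasSliceRankLE.of_restrict`, proved — and Prop. 3.2), applied to powers `I^a, I^b, I^{a+b}` of the augmentation ideal of `𝔽_p[P]` (Lemma 3.3), whose dimensions count Jennings monomials of bounded degree (Prop. 3.10, Jennings 1941), concentrated by Hoeffding: `slice-rank(M_P) ≤ 3|P|e^{−δ_P/18}`, `δ_P = (∑ j rⱼ)²/∑ j² rⱼ` (Thm. 3.11), with `δ_P = Ω(n)` under bounded variance / linear expectation / bounded length (Lemmas 3.16–3.18); a large Sylow subgroup (`|P| ≥ |G|^{Ω(1)}` by a prime count) and the normal-subgroup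 extension `slice-rank(𝔽[G]) ≤ |G/N|(codim I + codim J + dim IJ)` (Lemma 3.21) pass to nilpotent `G` (Thm. 3.19) [cite: BlasiakChurchCohnGrochowUmans2017, §3]; for `Gⁿ`: `𝔽_p[G]` is not semisimple for `p ∣ |G|` (a nilpotent ideal), which tensorises to an exponential slice-rank saving in `𝔽_p[Gⁿ] = 𝔽_p[G]^{⊗n}` (Sawin Lemmas 1.1–1.3) [cite: Sawin2018, Lemma 1.3].
evasions_known: (i) the method needs characteristic `p ∣ |G|`: semisimple group algebras have full slice rank (`BCCGU2017_corB7`, over every field: `.of_field`), as do the matrix multiplication tensors themselves (`BCCGU2017_propB6`) and all cyclic groups in every characteristic (`BCCGU2017_thmB8`, so `ℤ/p^kℤ` with `k → ∞` and `(ℤ/p^kℤ)^m` with `k` growing are not excluded, Ex. 3.13–3.14) [cite: BlasiakChurchCohnGrochowUmans2017, App. B and Ex. 3.13–3.14]; (ii) open directions named by the authors: nilpotent groups without the extra conditions, solvable groups of bounded exponent ("the most ambitious but realistic conjecture … every finite group `G` of bounded exponent has slice rank at most `|G|^{1−ε}`"), `p`-groups whose `p`-degrees have neither bounded variance nor linear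 expectation, and `Sₙ` (for which §5 names as "most ambitious conjecture" a slice-rank bound `≤ n!^{1/2}/e^{O(√n)}` — as printed untenable: `slice-rank_k(S_n) ≥ dim k[S_n]/J(k[S_n])` (quotient algebras, [cite: Pratt2022, Lemma 2.2 and Lemma 2.5]) is `n!` in characteristic `0` or `p > n`, `≥ (1 − o(1))n!` for `5√n ≤ p ≤ n` (Plancherel-typical partitions have `λ₁, λ₁' ∼ 2√n`, hence all hooks `< p`, and are `p`-cores, i.e. label blocks of defect zero), and `≥ n!·e^{−O(n)}` in characteristic `2` and `3` (defect-zero Specht modules of the cores `(k, k−1, …, 1)`, `(2k, 2k−2, …, 2)` restricted from `S_m ≤ S_n`; hook formula: `(f^λ)² ≈ n!·e^{−0.095n}` at `n = 3240`), all `≫ n!^{1/2}`; the operative open target, which would bar TPP sides `N ≥ n!^{1/2}e^{−O(√n)}` since `slice-rank ≥ N²` (Prop. B.6), is `slice-rank(S_n) ≤ n!·e^{−ω(√n)}`, cf. `YoungSubgroupBarrier.lean`; audit 2026-08-17, gen 2) [cite: BlasiakChurchCohnGrochowUmans2017, §5]; (iii) Sawin's general bound `δⁿ|G|ⁿ` "is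 never of the form `|G|^{1−c}`", so growing groups escape it; for groups with a normal `Hⁿ`, `H` indecomposable with trivial centre (Thm. 2.12 as printed; stated for non-abelian simple `H` in the introduction), matchings have density `≤ (1 − (2 − 3·2^{−2/3})/|H|)ⁿ`, and `≤ δ_pⁿ` with `lim δ_p ≈ 0.919` for `PSL₂(𝔽_p)ⁿ` [cite: Sawin2018, Thm. 2.12 and Thm. 3.10] [cite: BlasiakChurchCohnGrochowUmans2017, §1.1]. (iv) TIGHTNESS, `p → ∞`: every `p`-group of order `p^n` has border multiplicative matchings of cardinality `≥ p^n/2^n`, hence honest matchings of cardinality `(p/2)^{nN}/poly(N)` in `G^N` and `slice-rank_{𝔽_p}(M_{G^N}) ≥ (p/2)^{nN}/poly(N)`, and nilpotent `G` of order `p^n r`, `(p,r)=1`, have `slice-rank_{𝔽_p}(M_G) ≥ 3p^n r/2^{n+2}` [cite: BlasiakChurchCohnGrochowUmans2017, App. A (Lemma A.2, Prop. A.3, Thm. A.6 and Thm. A.7)] — so hypothesis (c) can hold only with `δ ≤ log 2/log p`, and NO slice-rank obstruction of the form `|G|^{1−Ω(1)}` exists for `p`-groups with `p → ∞` (Heisenberg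 `H(𝔽_p)`, extraspecial `p^{1+2k}`, `UT_3(𝔽_p)` with `p → ∞`: class `2`, exponent `p`): these are immune to the METHOD, not merely outside the theorems (see the module docstring on the printed proof of Prop. A.3); (v) slice rank is not tight for matchings: `M(PSL(2,p)) = O(p^{8/3})` by quasirandomness while `slice-rank(k[PSL(2,p)]) ≥ dim k[G]/J(k[G]) = Ω(p³)` over every field [cite: Pratt2022, Prop. 1.3 and Thm. 1.4] (refuting Petrov's conjecture `SR(G) ≤ M(G)|G|^{o(1)}`) — other obstructions to matchings exist where slice rank is blind (`QuasirandomBarrier.lean`); for `p`-groups in characteristic `p` that lower bound is `1` and no obstruction other than slice rank is known; (vi) the algebra-level form of (b): structure tensors of ALL non-semisimple algebras `A` (`N = dim A`, `rᵢ = dim rad^i/rad^{i+1}`) are unstable and irreversible with `S̃R(t_A) ≤ N·exp(−(∑ i rᵢ)²/(18N²∑ rᵢ²))`, whence "It is impossible to prove `ω = 2` using powers of structure tensors of non-semisimple algebras with bounded dimension" [cite: BlaserLysikov2020, Cor. 23 and Cor. 24] — same scope as Sawin (bounded dimension; combinatorial, any field, Rem. 26), growing families escape; (vii) hosts outside (a)–(c):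 finite groups of Lie type are treated in `QuasirandomBarrier.lean` / `NormalizerBarrier.lean` [cite: BlasiakCohnGrochowPrattUmans2023, §3], whose authors summarise in 2022 that beyond [BCCGNSU, BCCGU, Sawin] "the possibility that one could show `ω = 2` using a suitable family of nonabelian groups remains wide open" [cite: BlasiakCohnGrochowPrattUmans2023, §1]; INFINITE (Lie) hosts with separating functions [cite: BlasiakCohnGrochowPrattUmans2025, Thm. 2.2 and §1.1] are untouched by slice rank of finite group algebras; and on the abelian side the induced-matching/slice-rank obstruction "is the only obstruction to obtaining `ω = 2` via [(2.2)] that we are aware of" [cite: Pratt2024, §1]; (viii) GRADED certificates in the SAME hosts: BCGPU Thm. 2.2 with a separating SUBSET `R_sep ⊊ Irr(G)` (tree: `BCGPU2024_thm_2_2_corrected_holds`; route `LevelGradedCohnUmans`, crux `GradedPricing`) is benchmarked against `∑_{R_sep} d_ρ²`, not `|G|`, so Thm. 2.8 ("`ω = 2` ⟹ packing bound") does not start and this entry yields only the volume cap `n² ≤ slice-rank(D_G) ≤ |G|^{1−δ}` for a TPP triple of side `n` (`BCCGU2017_propB6.sq_le_sliceRank_of_realizesTPP`) [cite: BlasiakCohnGrochowPrattUmans2025,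 Thm. 2.2 and §1.1] [cite: BlasiakChurchCohnGrochowUmans2017, Thm. 2.8 and Prop. 2.10]; what survives of this entry for graded designs is the residual constraint `∑_{R_sep} d_ρ² ≤ n^{2+o(1)} ≤ slice-rank_{𝔽_p}(D_{G/K})^{1+o(1)} ≤ |G/K|^{(1−δ)(1+o(1))}` along any graded family certifying `ω = 2`, where `K = ⋂_{ρ ∈ R_sep} ker ρ` (the design lives in the faithful quotient `G/K`, again in the host class): the test space must be a polynomially small slice of the Plancherel mass of `G/K` — a constraint, not an impossibility; and the sub-case `R_sep = Irr(G/K)` (tests constant on `K`-cosets) IS (2.2) in `G/K` and stays blocked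
scope_caveats: (a) the printed theorems are qualitative ("cannot achieve `ω = 2`") statements about FAMILIES and bounds obtained "via Inequality (2.2)"; the Lean facts use the effective reading "(2.2) holds AT `w = 2 + ε`, `ε = ε(m,c) > 0`" (what the printed proof via Thm. 2.8 = BCCGNSU Lemma 2.4 yields; same reading as the tree's BCCGNSU Thm. B fact), and Cor. 2.11 is vendored for a group together with all its powers because its proof uses matchings in `G^N` and slice rank is not submultiplicative [cite: BlasiakChurchCohnGrochowUmans2017, Cor. 2.11 and Thm. 2.9]; (b) only Cor. 3.20 (bounded exponent AND class) is a Lean statement; Thm. 3.8 / 3.19 (bounded variance, linear expectation), Thm. 3.11 and Lemma 3.21 are cited only (no Jennings series / `p`-degrees in Mathlib) [cite: BlasiakChurchCohnGrochowUmans2017, Thm. 3.8, Thm. 3.11, Thm. 3.19, Lemma 3.21]; (c) BCCGU's printed Def. 2.5 mixes conventions — clause (1) uses its Def. 2.2 (TPP with RIGHT quotients `Q(S) = {xy⁻¹}`) while clause (2) is printed with LEFT quotients `s⁻¹s' t⁻¹t' u⁻¹u'` — and in non-abelian groups the left/right versions of clause (2) differ; the theorems it invokes (Thm. 2.6 = CKSU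 Thm. 5.5, the packing bounds, Thm. 2.8–2.9) are those of CKSU's Def. 5.1 (right quotients throughout), which is the tree's `SimultaneousTPP` and the notion used in the Lean facts here [cite: BlasiakChurchCohnGrochowUmans2017, Def. 2.2, Def. 2.5 and Thm. 2.6]; (d) Sawin's Thm. 1.5 bounds matchings in `Gⁿ` only; the step to "no `ω = 2` from `{Gⁿ}`" is BCCGU Thm. 2.8/2.9 [cite: BlasiakChurchCohnGrochowUmans2017, §1.1 and §2.3] — PROVED in the tree in the effective reading of (a) (audit 2026-08-17, `NilpotentGroupBarrierProofs.lean`): `Sawin2018_thm15_stpp` (for every non-trivial finite `G` there is `ε = ε(|G|) > 0` such that for EVERY `n` every STPP construction in `Gⁿ` satisfies (2.2) at `w = 2 + ε`) and `Sawin2018_thm15_rpow` (matchings in `Gⁿ` have size `≤ |Gⁿ|^{1−c}`, `c = c(G) > 0` — the shape "`|G|^{1−c}`" of BCCGU §1.1, available because `G` is fixed); quantitatively the tree's `δ = δ(|G|)` (`exists_sliceRank_mulGroupTensor_pi_le`) has `log(1/δ) ≈ 0.025/|G|`, so `c = log(1/δ)/log|G| ≈ 0.025/(|G| log|G|)` and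 `ε = 2c` (`ε ≈ 5·10⁻³` for `|G| = 6`, `≈ 2·10⁻⁴` for `|G| = 60`), while Sawin's printed `δ = e^{−2·instability²}`, instability `≥ 1/(3|G|)`, gives `c ≥ 2/(9|G|² log|G|)` [cite: Sawin2018, Lemma 1.1 and Lemma 1.2]: (b) is a statement about ONE fixed group with no uniformity in `|G|`, so a family `G_k^{n_k}` with `|G_k| → ∞` is outside (b) for every growth of `n_k` (immunity of the METHOD, as opposed to the theorem — no bound `slice-rank D_{G_kⁿ} ≤ |G_k|^{n(1−c)}` with `c > 0` uniform in `k` over any fields — is known for `p`-groups with `p → ∞` (evasion (iv), border matchings) and, through the semisimple-quotient bound `slice-rank_k D_{Gⁿ} ≥ (dim k[G]/J(k[G]))ⁿ` (the group algebra of a quotient, and `k[Gⁿ]/J`, are quotient ALGEBRAS, which cannot have larger slice rank [cite: Pratt2022, Lemma 2.2]; `(k[G]/J)^{⊗n}` is semisimple of full slice rank, Cor. B.7 / Prop. B.6), for every family with `dim k[G_k]/J(k[G_k]) ≥ |G_k|^{1−o(1)}` in ALL characteristics — e.g. `PSL₂(𝔽_p)`, `p → ∞`: `dim k[G]/J = Ω(p³)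 = Ω(|G|)` over every field [cite: Pratt2022, Thm. 1.4], so although `PSL₂(𝔽_p)ⁿ` has the uniform matching density `δ_p → 0.919` of Sawin Thm. 3.10, per coordinate the exponent is `log(1/δ_p)/log|PSL₂(𝔽_p)| → 0` and no characteristic can give more than `c = O(1/log p)`; audit 2026-08-17, gen 2); (e) none of this touches TPP/STPP constructions in groups of unbounded exponent, simple groups of Lie type (see `QuasirandomBarrier.lean`), or `Sₙ` beyond Young subgroups (see `YoungSubgroupBarrier.lean`). (f) the examples `UT_m(𝔽_p)`, `m → ∞` (Ex. 3.15) and the bounded-variance / linear-expectation families of Thm. 3.8 / 3.19 listed in technique_class (a) are covered in PRINT only; a card or route invoking this entry against such a family must cite the printed theorem, not the Lean Prop, whose clause (a) is Cor. 3.20 (bounded exponent AND class) [cite: BlasiakChurchCohnGrochowUmans2017, Ex. 3.15 and Thm. 3.8]; (g) within (a)–(c) the entry is a THEOREM of the tree (`NilpotentGroupBarrier_holds`, module docstring), so on a bounded-exponent, bounded-class nilpotent family it cannot be disputed, only left: by a host outside (a)–(c) (unbounded exponent, e.g. `p → ∞`, where by evasion (iv) even the method is void), or by a certificate that is not full-budget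 (2.2) (evasion (viii)); (h) the effective reading "(2.2) holds AT `w = 2 + ε`" blocks certifying `ω < 2 + ε` by a single construction plus outside knowledge only while `2 + ε` is below the best known upper bound on `ω`; for the qualitative "cannot achieve `ω = 2`" all readings agree, and the tree's proofs go through matching bounds in powers `G^N` (`NilpotentGroupBarrierMatchings.lean`), i.e. through the packing quantity rather than through (2.2) itself [cite: BlasiakChurchCohnGrochowUmans2017, Thm. 2.8 and Thm. 2.9]; (i) reach of (b) beyond pure powers (audit 2026-08-17; PRINT ONLY, not a conjunct): Sawin's Thm. 2.10(2)/2.12 bound `|K|·θ_Hⁿ`, `θ_H = 1 − (2 − 3·2^{−2/3})·dim I/|H|`, holds for every finite `K ⊵ Hⁿ` with `H` indecomposable of trivial centre (`Aut(Hⁿ) = Aut(H) ≀ Sₙ`) [cite: Sawin2018, Thm. 2.10 and Thm. 2.12], and for ANY non-trivial `H` BCCGU's Lemma 3.21 (whose printed proof uses only invariance of the ideal under conjugation by coset representatives) transfers the graded count `2#{deg < a} + #{deg ≥ 2a} ≤ 3δⁿ|H|ⁿ` of Lemma 1.3 from `Hⁿ` to `3δⁿ|K|` for every `K ⊵ Hⁿ`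 whose conjugation action preserves Sawin's degree filtration (it is `Aut(H) ≀ Sₙ`-invariant: coordinate permutations, diagonal automorphisms, inner automorphisms) [cite: BlasiakChurchCohnGrochowUmans2017, Lemma 3.21]; such a bound is `|K|^{1−Ω(1)}` exactly when `log[K : Hⁿ] = O(n)`, and these host classes are closed under the powers used by Thm. 2.9, so `H ≀ Cₙ`, `Hⁿ ⋊ Pₙ` with `Pₙ ≤ Sₙ`, `|Pₙ| ≤ e^{O(n)}`, and products `∏ᵢ Gᵢ` of non-trivial groups of bounded order (pigeonhole on isomorphism types plus `slice-rank(D_{A×B}) ≤ slice-rank(D_A)·|B|` [cite: BlasiakChurchCohnGrochowNaslundSawinUmans2017, Prop. 4.2]) are blocked exactly like `{Hⁿ}`; for the CKSU wreath hosts `K_n = H ≀ Sₙ` (`[K_n : Hⁿ] = n!`, `H` fixed) the same bound is only `|K_n|^{1−Θ_H(1/log n)}` — it does not exclude `ω = 2` from `{H ≀ Sₙ}` but, through the tree's effective chain (`SimultaneousTPP.sum_rpow_le_of_matching_bound`, `sum_rpow_le_charDegreePowSum_of_sum_rpow_le`), forces every STPP construction in `H ≀ Sₙ` to satisfy (2.2)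 at `w = 2 + 2n·log(1/δ_H)/log|K_n| = 2 + Θ_H(1/log n)`: a certificate from that family can approach `2` no faster than `c_H/log n` at stage `n`; (j) (audit 2026-08-17, gen 2) SUBGROUPS AND QUOTIENTS of the powers: (b) transfers to a subgroup `H ≤ Gⁿ` by restriction and to a quotient `Gⁿ/M` because `k[Gⁿ/M]` is a quotient algebra of `k[Gⁿ]` [cite: Pratt2022, Lemma 2.2], giving `slice-rank ≤ 3δⁿ|G|ⁿ` in both cases — a bound of the form `|·|^{1−Ω(1)}` only while `log[Gⁿ : H]`, resp. `log|M|`, is `≤ (1 − Ω(1))·n·log(1/δ_G)` (with the tree's `log(1/δ) ≈ 0.025/|G|`: index below `e^{0.025n/|G|}`); for NILPOTENT `G` every subgroup and quotient of every `Gⁿ` is nilpotent of class `≤ c(G)` and exponent `∣ exp G`, hence inside (a) = `BCCGU2017_cor320` (Lean); for non-nilpotent `G` (already `S₃`) subgroups of `Gⁿ` of exponential index are bounded-exponent groups outside (a)–(c) — the open "bounded exponent" direction of evasion (ii) — except where Sawin's Lemma 2.2 lifts a blocked NORMAL subgroup `M ⊴ H` with `|M| ≥ |H|^{Ω(1)}`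 (e.g. `M = H ∩ C₃ⁿ ⊴ H ≤ S₃ⁿ`, abelian of exponent `3`) [cite: Sawin2018, Lemma 2.1 and Lemma 2.2]; (k) (audit 2026-08-17, gen 2) WHICH `w` THE ENTRY CAN EVER REACH FOR A FIXED `G`: the chain of (b) forces (2.2) at `w = 2 + 2 log(1/δ)/log|G|` from `slice-rank D_{G^T} ≤ C(δ|G|)^{|T|}`, and any admissible `δ` is `≥ δ_G^{match} = limsup_n m(Gⁿ)^{1/n}/|G|` (matchings bound slice rank from below, Prop. 2.10); `δ^{match}` is supermultiplicative along extensions, `δ_G^{match} ≥ δ_N^{match} δ_{G/N}^{match}` (App. A, Lemma A.5 — PROVED for honest matchings as `IsMulMatching.extension` / `.card_mul_le_sliceRank_of_extension` in `NilpotentGroupBarrierSawin.lean`) [cite: BlasiakChurchCohnGrochowUmans2017, Lemma A.5], and `δ_{C_q}^{match} = θ_q/q` with `θ_q = min_ρ(1+ρ+⋯+ρ^{q−1})ρ^{−(q−1)/3}` (`θ₂ = 3/2^{2/3}`, `θ₃ ≈ 2.755`, `θ₅ ≈ 4.46`, `θ₇ ≈ 6.16`; lower bound for every integer `q ≥ 2`,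 tight for prime powers) [cite: KleinbergSawinSpeyer2018, Thm. 2]; hence for a fixed SOLVABLE `G` with composition factors `C_{p₁}, …, C_{p_r}` no slice-rank argument forces (2.2) below `w₀(G) = 2 + 2∑ᵢ log(pᵢ/θ_{pᵢ})/log|G| ≤ 2 + 2 log(2/θ₂)/log 2 ≈ 2.163` — e.g. `S₃`: `δ^{match} ∈ [θ₂θ₃/6, θ₃/3] ≈ [0.868, 0.918]` (upper value: Sawin's Lemma 2.2 over `𝔽₃` with `N = C₃ⁿ`), so PRINT bars `ω < 2.095` from `{S₃ⁿ}`, the METHOD at most `ω < 2.158`, and the tree's `ε(6) ≈ 5·10⁻³` bars `ω < 2.005` — all far below the record `ω < 2.3714`: for fixed solvable `G` this entry is an `ω = 2` barrier and NO obstruction to record improvements from `{Gⁿ}` (the same window as on the abelian side, where the record constructions live in `C₇^ℓ` [cite: Pratt2024, §1] while Thm. A stops at `2 + 2 log(7/θ₇)/log 7 ≈ 2.13`); for `G` with a non-abelian composition factor only `δ_G^{match} ≥ |G|^{c_{|G|}−1}`, `c_{|G|} > 2/3` (`> 3/4` for `|G| < 250`), is in print [cite: AlmanVassilevskaWilliams2018,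 Thm. 7.4], so there the method's conceivable reach extends to `w ≈ 2 + 2(1 − c_{|G|})`, i.e. possibly beyond the record, pending better matchings in powers of simple groups (Sawin §2–3 bound them only from above: `δ ≤ 1 − 0.11/|H|`, `δ_p → 0.919` for `PSL₂(𝔽_p)`) [cite: Sawin2018, Thm. 2.12 and Thm. 3.10]; finally every `T_G` monomially degenerates to a generalized Coppersmith–Winograd tensor of parameter `|G| − 2`, so the Galactic method on `T_G` for any `G` with `R̃(T_G) = |G|` reproduces the CW-line record analyses [cite: AlmanVassilevskaWilliams2018, Thm. 7.2 and Rem. 7.1] but, by (b′), never `ω = 2`, and "it does not rule out showing `ω = 2` by using a sequence `G₁, G₂, …` of groups such that `lim ω_g(T_{G_i}) = 2`" [cite: AlmanVassilevskaWilliams2018, Rem. 6.1]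
status: theorem (established; PROVED in the tree — `NilpotentGroupBarrier_holds`, see the module docstring; audit 2026-08-15: confirmed, prose sharpened; audit 2026-08-17 of the Sawin conjunct (b): confirmed at page level (Sawin pp. 1–3, 7; BCCGU p. 3), effective STPP form proved (`Sawin2018_thm15_stpp`, `Sawin2018_thm15_rpow`), caveats (d), (i) and evasion (iii) sharpened; second audit 2026-08-17 (gen 2, proof file `NilpotentGroupBarrierSawin.lean`): confirmed again at page level (Sawin pp. 2–6; BCCGU pp. 3–4 and App. A; Alman–Vassilevska Williams §6–7; Pratt 2022), Lemma A.5 proved (`IsMulMatching.extension`), block sharpened — technique_class (b′), caveat (d) (semisimple-quotient immunity), caveats (j) (subgroups/quotients of `Gⁿ`) and (k) (the reachable window: an `ω = 2` barrier, not a record barrier, for fixed solvable `G`), evasion (ii) (`Sₙ` conjecture as printed)) [cite: BlasiakChurchCohnGrochowUmans2017, Thm. 3.19 and Cor. 3.20] [cite: Sawin2018, Thm. 1.5] [cite: AlmanVassilevskaWilliams2018, Thm. 6.1] -/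
def NilpotentGroupBarrier : Prop :=
  BCCGU2017_cor320 ∧ BCCGU2017_cor211 ∧ Sawin2018_thm15

/-- Projection: Cor. 3.20. [cite: BlasiakChurchCohnGrochowUmans2017, Cor. 3.20] -/
theorem NilpotentGroupBarrier.cor320 (h : NilpotentGroupBarrier) : BCCGU2017_cor320 := h.1

/-- Projection: Cor. 2.11. [cite: BlasiakChurchCohnGrochowUmans2017, Cor. 2.11] -/
theorem NilpotentGroupBarrier.cor211 (h : NilpotentGroupBarrier) : BCCGU2017_cor211 := h.2.1

/-- Projection: Sawin 2018, Thm. 1.5. [cite: Sawin2018, Thm. 1.5] -/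
theorem NilpotentGroupBarrier.sawin (h : NilpotentGroupBarrier) : Sawin2018_thm15 := h.2.2

/-- Under the barrier, an STPP construction in a finite nilpotent group of exponent `≤ m` and class
`≤ c` never witnesses `∑ᵢ(|Sᵢ||Tᵢ||Uᵢ|)^{(2+ε)/3} > ∑ⱼ dⱼ^{2+ε}` — the shape a certificate of
`ω < 2 + ε` via (2.2) would need. [cite: BlasiakChurchCohnGrochowUmans2017, Cor. 3.20] -/
theorem NilpotentGroupBarrier.no_certificate (h : NilpotentGroupBarrier) (m c : ℕ) :
    ∃ ε : ℝ, 0 < ε ∧ ∀ (G : Type) [Group G] [Fintype G] [Group.IsNilpotent G],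
      Monoid.exponent G ≤ m → Group.nilpotencyClass G ≤ c →
      ∀ (N : ℕ) (S T U : Fin N → Finset G), SimultaneousTPP S T U →
        ¬ (charDegreePowSum G (2 + ε) <
            ∑ i, (((S i).card * (T i).card * (U i).card : ℕ) : ℝ) ^ ((2 + ε) / 3)) := by
  obtain ⟨ε, hε, hb⟩ := h.cor320 m c
  exact ⟨ε, hε, fun G _ _ _ hm hc N S T U hS hlt =>
    absurd (hb G hm hc N S T U hS) (not_le.2 hlt)⟩

/-- **What slice rank says about ONE TPP triple — and all it says about certificates that are not
benchmarked against `|G|` (audit 2026-08-15, evasion (viii)).** If a finite group `G` realizes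
`⟨n,n,n⟩` (Cohn–Umans 2003, Def. 2.1: a TPP triple `S, T, U` of side `n`; the tree's
`RealizesTPP`), then `n² ≤ slice-rank_K(D_G)` over EVERY field `K`: the triple embeds `⟨n,n,n⟩`
into the multiplication tensor as a coordinate restriction (Cohn–Umans 2003, Thm. 2.3 —
`RealizesTPP.tensorRestrictsTo`), slice rank is monotone under restriction, `⟨n,n,n⟩` has full
slice rank `n²` over every field (BCCGU 2017, Prop. B.6, hypothesis `h6`, derived over all fields by
`BCCGU2017_propB6.of_field`), and `M_G`, `D_G` have the same slice rank (`sliceRank_groupTensor`).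
In the hosts of this entry this caps the side of a TPP triple at `|G|^{(1−δ)/2}` — an obstruction to
`ω = 2` only for certificates whose right-hand side is `≥ |G|` (the full-budget (2.2)), not for the
graded certificates of Blasiak–Cohn–Grochow–Pratt–Umans 2025, Thm. 2.2 with `R_sep ⊊ Irr(G)`.
[cite: BlasiakChurchCohnGrochowUmans2017, Prop. 2.10 and Prop. B.6] [cite: CohnUmans2003, Thm. 2.3] -/
theorem BCCGU2017_propB6.sq_le_sliceRank_of_realizesTPP (h6 : BCCGU2017_propB6) (K : Type) [Field K]
    (G : Type u) [Group G] [Fintype G] [DecidableEq G] {n : ℕ}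
    (h : Literature.Computability.AlgebraicComplexity.RealizesTPP G n n n) :
    n ^ 2 ≤ sliceRank (mulGroupTensor K G) :=
  calc n ^ 2 = sliceRank (Literature.Computability.AlgebraicComplexity.matMulTensor K n n n) :=
        (h6.of_field K n).symm
    _ ≤ sliceRank (Literature.Computability.AlgebraicComplexity.groupTensor K G) :=
        sliceRank_le_of_tensorRestrictsTo (h.tensorRestrictsTo K)
    _ = sliceRank (mulGroupTensor K G) := sliceRank_groupTensor K G

end Catalogue

end Literature.Barriers.MatrixMultiplication
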